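import Summits.AtomisticToContinuum.HydrodynamicLimit.Theorems.TwoClocksEquilibriumFastWindowLDBirthT12Euler
import HarnessLib

/-!
# The dipole Euler–Volterra equation of the Lorentz limit with a GROWING right side
# (helper `t12_euler_dipole_logSqGrowth` of the line `birth`, crux `TwoClocks.EquilibriumFastWindowLD`,
# stmt-AtomisticToContinuum-14440; first bootstrap round of items T1/T2, sector `ℓ = 1`, of the
# registered sub-goal `t12_logLinearPreimage_and_dipoleModulus`)

File `…BirthT12Euler` solves the `ℓ = 1` Euler–Volterra equation of the far-field linearised
hard-sphere operator, `Φ(s) = (4/s⁴) ∫₀ˢ t³ Φ(t) dt - γ(s)` (`s ≥ s₀`), for a BOUNDED right side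
`‖γ‖ ≤ Γ`: log growth `‖Φ(s)‖ ≲ log s` and the log-modulus `‖Φ(r) - Φ(S)‖ ≤ 4Γ log(S/r) + 2Γ`
(`euler_dipole_norm_le`, `t12_euler_dipole_logModulus`). In the first bootstrap round for the dipole
profile of the corrector the right side grows: the a-priori size `‖Φ(s)‖ ≲ s (1 + log s)` of the
profile of a quadratic-log `Π₁ψ` gives, after division by `ν ≍ s`, `‖γ(s)‖ ≤ Γ (1 + log(1+s))`.
From the representation `Φ(S) - Φ(r) = -4∫ᵣ^S γ(u) du/u - (γ(S) - γ(r))` (`euler_dipole_sub_eq`) and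
`‖γ‖ ≤ Γ w(S)` on `[r, S]` for a nondecreasing weight `w` this file proves what comes out:

* `euler_dipole_modulus_of_monotoneOn` — (EG1b) `‖γ‖ ≤ Γ w`, `w` monotone on `[s₀, ∞)`, `Γ ≥ 0` ⟹
  `‖Φ(r) - Φ(S)‖ ≤ 4Γ w(S) log(S/r) + 2Γ w(S)` (`s₀ ≤ r ≤ S`);
* `euler_dipole_norm_le_of_monotoneOn` — (EG1a) `‖Φ(s)‖ ≤ 4‖Ψ(s₀)‖/s₀⁴ + 4Γ w(s) log(s/s₀) + Γ w(s)`
  (`Ψ(s₀) = ∫₀^{s₀} t³Φ`);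
* `euler_dipole_logSqGrowth` (any complete normed space) and the **registered helper
  `t12_euler_dipole_logSqGrowth`** (its `ℝ³` instance) — for `w = 1 + log(1+s)` and `s₀ ≥ 1`:
  **`‖Φ(s)‖ ≤ 4‖Ψ(s₀)‖/s₀⁴ + 5Γ (1 + log(1+s))²`** (squared-log growth: the `ℓ = 1` log-resonance
  integrates `∫ log t dt/t = log²/2`) and the log-weighted modulus
  **`‖Φ(r) - Φ(S)‖ ≤ 4Γ (1 + log(1+S)) log(S/r) + 2Γ (1 + log(1+S))`**.

The final round (bounded `γ`) is the landed `euler_dipole_logModulus`; the zonal rounds are in the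
sibling file `…BirthT12EulerGrowth`. Hypotheses as in `…BirthT12Euler` (`Φ` continuous on `(0, ∞)`,
`t³Φ` integrable on `[0, s₀]`, the identity on `[s₀, ∞)`). Pure real analysis, [folklore].
-/

noncomputable section

open MeasureTheory Real Set Filter intervalIntegral
open scoped ENNReal BigOperators Topology

namespace Summit.AtomisticToContinuum.HydrodynamicLimit.Theorems.ClampedCorrectorBirth

/-! ### `ℓ = 1`: the dipole sector with a monotone weight -/

section Dipole

variable {E : Type*} [NormedAddCommGroup E] [NormedSpace ℝ E] [CompleteSpace E]

/-- **(EG1b) The dipole modulus with a growing right side, general normed space.** A solution of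
the `ℓ = 1` Euler–Volterra equation `Φ(s) = (4/s⁴) ∫₀ˢ t³ Φ(t) dt - γ(s)` (`s ≥ s₀ > 0`) whose right
side is bounded by a MONOTONE weight, `‖γ(s)‖ ≤ Γ w(s)`, `w` nondecreasing on `[s₀, ∞)`, `Γ ≥ 0`, has
the modulus **`‖Φ(r) - Φ(S)‖ ≤ 4Γ w(S) log(S/r) + 2Γ w(S)`** for `s₀ ≤ r ≤ S` (the representation
`Φ(S) - Φ(r) = -4∫ᵣ^S γ du/u - (γ(S) - γ(r))` of `euler_dipole_sub_eq` with `‖γ‖ ≤ Γ w(S)` on `[r, S]`).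
[folklore] -/
theorem euler_dipole_modulus_of_monotoneOn {Φ γ : ℝ → E} {w : ℝ → ℝ} {Γ s₀ : ℝ} (hs₀ : 0 < s₀)
    (hΓ : 0 ≤ Γ) (hΦ : ContinuousOn Φ (Ioi 0))
    (hint : IntervalIntegrable (fun t => t ^ 3 • Φ t) volume 0 s₀) (hw : MonotoneOn w (Ici s₀))
    (hγ : ∀ s, s₀ ≤ s → ‖γ s‖ ≤ Γ * w s)
    (hE : ∀ s, s₀ ≤ s → Φ s = (4 / s ^ 4) • (∫ t in (0:ℝ)..s, t ^ 3 • Φ t) - γ s)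
    {r S : ℝ} (hr : s₀ ≤ r) (hrS : r ≤ S) :
    ‖Φ r - Φ S‖ ≤ 4 * Γ * w S * Real.log (S / r) + 2 * Γ * w S := by
  have hr0 : 0 < r := hs₀.trans_le hr
  have hγ' : ∀ u, r ≤ u → u ≤ S → ‖γ u‖ ≤ Γ * w S := fun u hu huS =>
    (hγ u (hr.trans hu)).trans (mul_le_mul_of_nonneg_left
      (hw (show u ∈ Ici s₀ from hr.trans hu) (show S ∈ Ici s₀ from hr.trans hrS) huS) hΓ)
  have hI := norm_integral_inv_smul_le (γ := γ) (Γ := Γ * w S) hr0 hrS hγ'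
  rw [norm_sub_rev, euler_dipole_sub_eq hs₀ hΦ hint hE hr hrS]
  calc ‖-((4:ℝ) • ∫ u in r..S, u⁻¹ • γ u) - (γ S - γ r)‖
        ≤ ‖-((4:ℝ) • ∫ u in r..S, u⁻¹ • γ u)‖ + ‖γ S - γ r‖ := norm_sub_le _ _
    _ ≤ 4 * ‖∫ u in r..S, u⁻¹ • γ u‖ + (‖γ S‖ + ‖γ r‖) := by
        rw [norm_neg, norm_smul, Real.norm_of_nonneg (by norm_num : (0:ℝ) ≤ 4)]
        exact add_le_add le_rfl (norm_sub_le (γ S) (γ r))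
    _ ≤ 4 * (Γ * w S * Real.log (S / r)) + (Γ * w S + Γ * w S) := by
        gcongr
        · exact hγ' S hrS le_rfl
        · exact hγ' r le_rfl hrS
    _ = 4 * Γ * w S * Real.log (S / r) + 2 * Γ * w S := by ring

/-- **(EG1a) Growth in the dipole sector with a growing right side, general normed space**: under
the hypotheses of `euler_dipole_modulus_of_monotoneOn`,
`‖Φ(s)‖ ≤ 4‖Ψ(s₀)‖/s₀⁴ + 4Γ w(s) log(s/s₀) + Γ w(s)` for `s ≥ s₀`, `Ψ(s₀) = ∫₀^{s₀} t³ Φ`. [folklore] -/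
theorem euler_dipole_norm_le_of_monotoneOn {Φ γ : ℝ → E} {w : ℝ → ℝ} {Γ s₀ : ℝ} (hs₀ : 0 < s₀)
    (hΓ : 0 ≤ Γ) (hΦ : ContinuousOn Φ (Ioi 0))
    (hint : IntervalIntegrable (fun t => t ^ 3 • Φ t) volume 0 s₀) (hw : MonotoneOn w (Ici s₀))
    (hγ : ∀ s, s₀ ≤ s → ‖γ s‖ ≤ Γ * w s)
    (hE : ∀ s, s₀ ≤ s → Φ s = (4 / s ^ 4) • (∫ t in (0:ℝ)..s, t ^ 3 • Φ t) - γ s)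
    {s : ℝ} (hs : s₀ ≤ s) :
    ‖Φ s‖ ≤ 4 * ‖∫ t in (0:ℝ)..s₀, t ^ 3 • Φ t‖ / s₀ ^ 4 + 4 * Γ * w s * Real.log (s / s₀)
      + Γ * w s := by
  have hγ' : ∀ u, s₀ ≤ u → u ≤ s → ‖γ u‖ ≤ Γ * w s := fun u hu hus =>
    (hγ u hu).trans (mul_le_mul_of_nonneg_left
      (hw (show u ∈ Ici s₀ from hu) (show s ∈ Ici s₀ from hs) hus) hΓ)
  have hI := norm_integral_inv_smul_le (γ := γ) (Γ := Γ * w s) hs₀ hs hγ'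
  have hrep : Φ s = (4 / s₀ ^ 4) • (∫ t in (0:ℝ)..s₀, t ^ 3 • Φ t)
      - (4:ℝ) • (∫ u in s₀..s, u⁻¹ • γ u) - γ s := by
    have h := euler_dipole_sub_eq hs₀ hΦ hint hE le_rfl hs
    rw [hE s₀ le_rfl, sub_eq_iff_eq_add] at h
    rw [h]
    module
  rw [hrep]
  calc ‖(4 / s₀ ^ 4) • (∫ t in (0:ℝ)..s₀, t ^ 3 • Φ t) - (4:ℝ) • (∫ u in s₀..s, u⁻¹ • γ u) - γ s‖
        ≤ ‖(4 / s₀ ^ 4) • (∫ t in (0:ℝ)..s₀, t ^ 3 • Φ t)‖ + ‖(4:ℝ) • (∫ u in s₀..s, u⁻¹ • γ u)‖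
          + ‖γ s‖ := (norm_sub_le _ _).trans (add_le_add (norm_sub_le _ _) le_rfl)
    _ ≤ 4 * ‖∫ t in (0:ℝ)..s₀, t ^ 3 • Φ t‖ / s₀ ^ 4 + 4 * (Γ * w s * Real.log (s / s₀))
          + Γ * w s := by
        rw [norm_smul, norm_smul, Real.norm_of_nonneg (by positivity : (0:ℝ) ≤ 4 / s₀ ^ 4),
          Real.norm_of_nonneg (by norm_num : (0:ℝ) ≤ 4), div_mul_eq_mul_div]
        gcongr
        exact hγ' s hs le_rfl
    _ = _ := by ring

/-- **(EG1) The first bootstrap round of the dipole sector: squared-log growth and the log-weighted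
modulus.** If `Φ : (0, ∞) → E` solves `Φ(s) = (4/s⁴) ∫₀ˢ t³ Φ(t) dt - γ(s)` for `s ≥ s₀ ≥ 1` with
`‖γ(s)‖ ≤ Γ (1 + log(1+s))`, then for `s ≥ s₀` and `s₀ ≤ r ≤ S`:
**`‖Φ(s)‖ ≤ 4‖Ψ(s₀)‖/s₀⁴ + 5Γ (1 + log(1+s))²`** (`Ψ(s₀) = ∫₀^{s₀} t³Φ`; `log(s/s₀) ≤ 1 + log(1+s)`
as `s₀ ≥ 1`) and **`‖Φ(r) - Φ(S)‖ ≤ 4Γ (1 + log(1+S)) log(S/r) + 2Γ (1 + log(1+S))`**. The final round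
(bounded `γ`) is `euler_dipole_logModulus` / `euler_dipole_norm_le`. [folklore] -/
theorem euler_dipole_logSqGrowth {Φ γ : ℝ → E} {Γ s₀ : ℝ} (hs₀ : 1 ≤ s₀)
    (hΦ : ContinuousOn Φ (Ioi 0)) (hint : IntervalIntegrable (fun t => t ^ 3 • Φ t) volume 0 s₀)
    (hγ : ∀ s, s₀ ≤ s → ‖γ s‖ ≤ Γ * (1 + Real.log (1 + s)))
    (hE : ∀ s, s₀ ≤ s → Φ s = (4 / s ^ 4) • (∫ t in (0:ℝ)..s, t ^ 3 • Φ t) - γ s) :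
    (∀ s, s₀ ≤ s → ‖Φ s‖ ≤ 4 * ‖∫ t in (0:ℝ)..s₀, t ^ 3 • Φ t‖ / s₀ ^ 4
        + 5 * Γ * (1 + Real.log (1 + s)) ^ 2) ∧
      ∀ r S : ℝ, s₀ ≤ r → r ≤ S → ‖Φ r - Φ S‖ ≤
        4 * Γ * (1 + Real.log (1 + S)) * Real.log (S / r) + 2 * Γ * (1 + Real.log (1 + S)) := by
  have hs₀' : 0 < s₀ := one_pos.trans_le hs₀
  have hm : ∀ s : ℝ, 0 ≤ s → 1 ≤ 1 + Real.log (1 + s) := fun s hs => by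
    have := Real.log_nonneg (by linarith : (1:ℝ) ≤ 1 + s)
    linarith
  have hΓ : 0 ≤ Γ := nonneg_of_mul_nonneg_left ((norm_nonneg _).trans (hγ s₀ le_rfl))
    (lt_of_lt_of_le one_pos (hm s₀ hs₀'.le))
  have hw : MonotoneOn (fun s : ℝ => 1 + Real.log (1 + s)) (Ici s₀) := by
    intro u (hu : s₀ ≤ u) v _ huv
    simp only
    gcongr
    linarith
  refine ⟨fun s hs => ?_, fun r S hr hrS =>
    euler_dipole_modulus_of_monotoneOn hs₀' hΓ hΦ hint hw hγ hE hr hrS⟩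
  have h := euler_dipole_norm_le_of_monotoneOn hs₀' hΓ hΦ hint hw hγ hE hs
  have hs' : 0 < s := hs₀'.trans_le hs
  have hm1 : 1 ≤ 1 + Real.log (1 + s) := hm s hs'.le
  have hlog : Real.log (s / s₀) ≤ 1 + Real.log (1 + s) := by
    have h1 : Real.log (s / s₀) ≤ Real.log (1 + s) :=
      Real.log_le_log (by positivity) ((div_le_self hs'.le hs₀).trans (by linarith))
    linarith
  refine h.trans ?_
  have hΓm : 0 ≤ Γ * (1 + Real.log (1 + s)) := mul_nonneg hΓ (by linarith)
  nlinarith [mul_le_mul_of_nonneg_left hlog hΓm, mul_le_mul_of_nonneg_left hm1 hΓm]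

end Dipole

/-- **Registered helper `t12_euler_dipole_logSqGrowth` (EG1: the first bootstrap round of T1/T2 in
the sector `ℓ = 1`).** The `ℓ = 1` (dipole) profile `Φ : (0, ∞) → ℝ³` of the corrector solves, in the
far field, `Φ(s) = (4/s⁴) ∫₀ˢ t³ Φ(t) dt - γ(s)` for `s ≥ s₀ ≥ 1`; in the first round the right side
is only known to grow logarithmically, `‖γ(s)‖ ≤ Γ (1 + log(1+s))`. Consequences (pure real analysis):
the SQUARED-LOG GROWTH **`‖Φ(s)‖ ≤ 4‖Ψ(s₀)‖/s₀⁴ + 5Γ (1 + log(1+s))²`** (`s ≥ s₀`,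
`Ψ(s₀) = ∫₀^{s₀} t³Φ`) and the LOG-WEIGHTED MODULUS
**`‖Φ(r) - Φ(S)‖ ≤ 4Γ (1 + log(1+S)) log(S/r) + 2Γ (1 + log(1+S))`** (`s₀ ≤ r ≤ S`). Proof:
`Φ(S) - Φ(r) = -4∫ᵣ^S γ du/u - (γ(S) - γ(r))` with `‖γ‖ ≤ Γ(1 + log(1+S))` on `[r, S]`. [folklore] -/
theorem t12_euler_dipole_logSqGrowth : ∀ (Φ γ : ℝ → EuclideanSpace ℝ (Fin 3)) (Γ s₀ : ℝ), 1 ≤ s₀ → ContinuousOn Φ (Set.Ioi 0) → IntervalIntegrable (fun t => t ^ 3 • Φ t) MeasureTheory.volume 0 s₀ → (∀ s, s₀ ≤ s → ‖γ s‖ ≤ Γ * (1 + Real.log (1 + s))) → (∀ s, s₀ ≤ s → Φ s = (4 / s ^ 4) • (∫ t in (0:ℝ)..s, t ^ 3 • Φ t) - γ s) → (∀ s, s₀ ≤ s → ‖Φ s‖ ≤ 4 * ‖∫ t in (0:ℝ)..s₀, t ^ 3 • Φ t‖ / s₀ ^ 4 + 5 * Γ * (1 + Real.log (1 + s)) ^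 2) ∧ ∀ r S : ℝ, s₀ ≤ r → r ≤ S → ‖Φ r - Φ S‖ ≤ 4 * Γ * (1 + Real.log (1 + S)) * Real.log (S / r) + 2 * Γ * (1 + Real.log (1 + S)) :=
  fun _ _ _ _ hs₀ hΦ hint hγ hE => euler_dipole_logSqGrowth hs₀ hΦ hint hγ hE

end Summit.AtomisticToContinuum.HydrodynamicLimit.Theorems.ClampedCorrectorBirth

end
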